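import Summits.BirchSwinnertonDyer.Rank1Residual.Additive.SubGordThree
import Literature.NumberTheory.DiophantineGeometry.ConductorTameProofs
import HarnessLib

/-!
# X3♯(G-ord) / X4♯(G-ord): the census dictionary UNIFORMLY in the prime — (G) = the census cell at every odd `p`; the wild cell is empty at `p ≥ 5`

HONEST FRAMING (cell `b2b-bsdres`, run/shared/lean/b2b/bsd-rank1-residual/, verbatim in every
file): the goal of the cell is to DELETE the COMBINATION-SHAPED residual classes of the
Birch–Swinnerton-Dyer formula for ALL analytic-rank `≤ 1` elliptic curves over `ℚ` — "full BSD
formula for every rank `≤ 1` curve in class `C`" assembled STRICTLY from published theorems — so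
that the rank-`≤ 1` remainder becomes exactly the CONSTRUCTION-SHAPED classes, which are TYPED
(missing-input `Prop`s), NOT attempted. This is not "finishing BSD". Sub-cell `additive-p2`
(CLASS-OWNERS row "X3/X4 additive — pot. good ordinary / X3♯(G-ord)"), generation 9: research
route; no claim beyond the stated classes; theorems only, no definition, no new named fact;
X3♯(G-ord)/X4♯(G-ord) stay CONSTRUCTION-SHAPED; no label moves.

WHAT THIS FILE DOES (gen-8 NEXT (b): "a uniform-in-`p` restatement of `typeG_of_subGord`"). The
hyp seat's census splits an additive prime `p` of `E/ℚ` into four data cells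
(`SharpenedStatements.lean`, `sub_exhaustive`): (M) `SubM` = `ord_p j < 0`; (G-ord census cell)
`SubGord` = `ord_p j ≥ 0 ∧ f_p = 2 ∧ e_E(p) ∣ p − 1`; (T′) `SubTprime` = `ord_p j ≥ 0 ∧ f_p = 2 ∧
e_E(p) ∤ p − 1`; (W) `SubW` = `ord_p j ≥ 0 ∧ f_p ≠ 2`. Gen 2 proved `SubGord ↔ TypeG ∧ f_p = 2`
at `p ≥ 5` and gen 8 `SubGord W 3 ↔ TypeG W 3`. Here the conductor bit is discharged at `p ≥ 5`
from the tree's Ogg–Saito/Tate-algorithm facts (Silverman *ATAEC* IV.10.2(b)/IV.10.4: an additive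
`p ≥ 5` has `f_p = 2` — `WeierstrassCurve.conductorExponent_eq_tameConductorExponent_holds`,
`KodairaSymbol.tameConductorExponent_eq_two_iff`, `isAdditive_kodairaSymbolAt_iff_holds`), giving
ONE statement at every odd prime:

* `condExpTwo_of_addv_of_five_le` — `Addv W p`, `p ≥ 5` ⟹ `CondExpTwo W p` (`f_p(E) = 2`);
* `not_subW_of_addv_of_five_le` — the wild cell (W) is EMPTY at `p ≥ 5`;
  `subM_or_subGord_or_subTprime_of_addv` — the census trichotomy (M) / (G) / (T′) at `p ≥ 5`;
* **`subGord_iff_typeG_of_addv`** — for EVERY odd prime `p` and `E` additive at `p`: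
  `SubGord W p ↔ TypeG W p` — the census cell (G-ord) IS Delbourgo's (G);
* `subTprime_iff_not_potMult_and_not_typeG` — at `p ≥ 5`, (T′) = "potentially good, not (G)"
  (by `PotentiallyOrdinaryTypeG.lean`, gen 9, such pairs are potentially SUPERSINGULAR);
* **`classX3Gord_iff_subGord`** — for EVERY odd `p`, on the Eisenstein class X3 the sub-class
  X3♯(G-ord) IS the census cell: `ClassX3 W p → (ClassX3Gord W p ↔ SubGord W p)` (the ordinarity
  bit is automatic on X3: gen 3's `classX3Gord_of_subGord` — Serre's Prop. 12 on the reducible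
  twist — at `p ≥ 5`, gen 8's `classX3Gord_three_iff_subGord` at `p = 3`);
* `classX4Gord_iff_subGord_of_semistabilityIndex_ne_two` — on X4 with defect `≠ 2` likewise
  (`p ≥ 5`); for defect `2` the extra bit is genuine (`p ∤ a_p(E^{(p*)})`, gen 4's
  `classX4Gord_iff_goodOrd_twist_pStar`, gen 8's `classX4Gord_three_iff_subGord`).

(At `p = 2` Delbourgo's (G) is vacuous on the additive locus — `ℚ(ζ₂) = ℚ` — and the cell's
partition routes `p = 2` to class X5; not formalised here.) Nothing here changes a label.

References: J. H. Silverman, *ATAEC* IV.10.2(b), IV.10.4, IV.11.1 (Ogg's formula), IV.9.4 Table 4.1;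
A. P. Ogg, Amer. J. Math. 89 (1967); D. Delbourgo, Compositio Math. 113 (1998) §1.5 (G);
J.-P. Serre, Invent. Math. 15 (1972) Prop. 12; HOME/b2b-bsdres-hyp/hyp/SHARPENED-CONJECTURES.md §3.
-/

noncomputable section

open scoped Classical NumberField

open WeierstrassCurve IsDedekindDomain IsDedekindDomain.HeightOneSpectrum NumberField
  Rat.HeightOneSpectrum Literature.NumberTheory.EllipticCurves
  Literature.NumberTheory.EllipticCurves.Rank1Residual Literature.NumberTheory.DiophantineGeometry

namespace Summit.BirchSwinnertonDyer.Rank1Residual.Additive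

variable (W : WeierstrassCurve ℚ) [W.IsElliptic] [W.IsGloballyMinimal] (p : ℕ) [hp : Fact p.Prime]

/-! ### `f_p = 2` at an additive `p ≥ 5` -/

omit [W.IsGloballyMinimal] in
/-- **An additive prime `p ≥ 5` has conductor exponent `f_p(E) = 2`** (the census bit "tame",
`CondExpTwo W p`, at the place of `ℤ` over `p`). Silverman *ATAEC* IV.10.2(b), IV.10.4: in
residue characteristic `≥ 5` the conductor exponent is the tame one, `= 2` exactly for the
additive Kodaira types (tree: `conductorExponent_eq_tameConductorExponent_holds`,
`KodairaSymbol.tameConductorExponent_eq_two_iff`, `isAdditive_kodairaSymbolAt_iff_holds`;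
bridge `𝓞 ℚ`/`ℤ`: `conductorExponent_ringOfIntegers_eq`).
[cite: SilvermanATAEC1994, IV.10.2(b) and IV.10.4] -/
theorem condExpTwo_of_addv_of_five_le (hp5 : 5 ≤ p) (hadd : Addv W p) : CondExpTwo W p := by
  set u : HeightOneSpectrum (𝓞 ℚ) := (primesEquiv (R := 𝓞 ℚ)).symm ⟨p, hp.out⟩ with hudef
  have hu : (primesEquiv u : ℕ) = p := by rw [hudef, Equiv.apply_symm_apply]
  have hpu : (p : 𝓞 ℚ) ∈ u.asIdeal := (natCast_mem_asIdeal_iff_eq_primesEquiv_symm u hp.out).mpr rfl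
  have hadd' : W.HasAdditiveReductionAt u := hasAdditiveReductionAt_of_addv W p hadd
  have hchar : ringChar (𝓞 ℚ ⧸ u.asIdeal) = p := by
    haveI : Nontrivial (𝓞 ℚ ⧸ u.asIdeal) := Ideal.Quotient.nontrivial_iff.mpr u.isPrime.ne_top
    apply CharP.ringChar_of_prime_eq_zero hp.out
    rw [← map_natCast (Ideal.Quotient.mk u.asIdeal) p, Ideal.Quotient.eq_zero_iff_mem]
    exact hpu
  haveI : Finite (IsLocalRing.ResidueField (u.adicCompletionIntegers ℚ)) :=
    HeightOneSpectrum.finite_residueField_adicCompletionIntegers ℚ u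
  haveI : PerfectField (IsLocalRing.ResidueField (u.adicCompletionIntegers ℚ)) :=
    PerfectField.ofFinite
  have hf : W.conductorExponent u = 2 := by
    rw [W.conductorExponent_eq_tameConductorExponent_holds u (by rw [hchar]; omega)
      (by rw [hchar]; omega), KodairaSymbol.tameConductorExponent_eq_two_iff]
    exact (W.isAdditive_kodairaSymbolAt_iff_holds u).mpr hadd'
  rw [conductorExponent_ringOfIntegers_eq W u, hudef, Equiv.apply_symm_apply] at hf
  exact hf

omit [W.IsGloballyMinimal] in
/-- **The wild census cell (W) is EMPTY at an additive `p ≥ 5`**: `SubW W p` (`ord_p j ≥ 0 ∧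
f_p ≠ 2`) fails. -/
theorem not_subW_of_addv_of_five_le (hp5 : 5 ≤ p) (hadd : Addv W p) : ¬ SubW W p :=
  fun h ↦ h.2 (condExpTwo_of_addv_of_five_le W p hp5 hadd)

/-- **The census trichotomy at an additive `p ≥ 5`**: (M) potentially multiplicative, or the
(G-ord) cell, or (T′) — `sub_exhaustive` with the wild cell removed. -/
theorem subM_or_subGord_or_subTprime_of_addv (hp5 : 5 ≤ p) (hadd : Addv W p) :
    SubM W p ∨ SubGord W p ∨ SubTprime W p := by
  rcases sub_exhaustive W p with h | h | h | h
  · exact Or.inl h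
  · exact Or.inr (Or.inl h)
  · exact Or.inr (Or.inr h)
  · exact absurd h (not_subW_of_addv_of_five_le W p hp5 hadd)

/-! ### (G) = the census cell, at every odd prime -/

omit hp in
/-- An odd prime is `3` or at least `5`. -/
theorem eq_three_or_five_le_of_prime_ne_two (hp' : p.Prime) (hp2 : p ≠ 2) : p = 3 ∨ 5 ≤ p := by
  have h2 := hp'.two_le
  have h4 : p ≠ 4 := by rintro rfl; exact absurd hp' (by decide)
  omega

/-- **THE DICTIONARY, UNIFORM IN `p`: for every odd prime `p` and `E` additive at `p`, the census
cell (G-ord) IS Delbourgo's class (G)** — `SubGord W p ↔ TypeG W p`. At `p ≥ 5`: gen 2's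
`subGord_iff_typeG_and_condExpTwo` (cyclotomic good-reduction criterion, `e_E(p) ∣ p − 1`) with the
conductor bit discharged by `condExpTwo_of_addv_of_five_le`; at `p = 3`: gen 8's
`subGord_three_iff_typeG` (Tate's algorithm at `3`). -/
theorem subGord_iff_typeG_of_addv (hp2 : p ≠ 2) (hadd : Addv W p) : SubGord W p ↔ TypeG W p := by
  rcases eq_three_or_five_le_of_prime_ne_two p hp.out hp2 with h3 | hp5
  · subst h3
    exact subGord_three_iff_typeG W hadd
  · rw [subGord_iff_typeG_and_condExpTwo W p hp5]
    exact ⟨fun h ↦ h.1, fun h ↦ ⟨h, condExpTwo_of_addv_of_five_le W p hp5 hadd⟩⟩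

/-- **(T′) = "potentially good, not (G)"** at an additive `p ≥ 5`: `SubTprime W p ↔ ¬ PotMult W p ∧
¬ TypeG W p`. (Such pairs are potentially SUPERSINGULAR at every place of good reduction above `p`
of every number field: `SubTprime.not_hasUnitRootAt_baseChange`, `PotentiallyOrdinaryTypeG.lean`.) -/
theorem subTprime_iff_not_potMult_and_not_typeG (hp5 : 5 ≤ p) (hadd : Addv W p) :
    SubTprime W p ↔ ¬ PotMult W p ∧ ¬ TypeG W p := by
  rw [typeG_iff_not_subM_and_semistabilityIndex_dvd W p hp5]
  have hf := condExpTwo_of_addv_of_five_le W p hp5 hadd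
  unfold SubTprime SubM
  tauto

/-- **Every additive potentially good pair at `p ≥ 5` is (G) or (T′), never both**:
`¬ PotMult W p → (TypeG W p ↔ ¬ SubTprime W p)`. -/
theorem typeG_iff_not_subTprime_of_not_potMult (hp5 : 5 ≤ p) (hadd : Addv W p)
    (hj : ¬ PotMult W p) : TypeG W p ↔ ¬ SubTprime W p := by
  rw [subTprime_iff_not_potMult_and_not_typeG W p hp5 hadd]
  tauto

/-! ### Class level: X3♯(G-ord) is the census cell on X3, at every odd prime -/

/-- **On the Eisenstein additive class X3, the sub-class X3♯(G-ord) IS the census cell (G-ord), at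
EVERY odd prime**: `ClassX3 W p → (ClassX3Gord W p ↔ SubGord W p)`. The ordinarity bit of
`TypeGOrd` is automatic on X3 — at `p ≥ 5` by gen 3's `classX3Gord_of_subGord` (defect `3,4,6`:
Deuring; defect `2`: the twist `E^{(p*)}` has reducible `E'[p]` and good reduction, hence is
ordinary by Serre's Prop. 12), at `p = 3` by gen 8's `classX3Gord_three_iff_subGord`; the converse
is `TypeGOrd → TypeG → SubGord` (`subGord_iff_typeG_of_addv`). So for X3 the census count
334 ‖ 191 of X3♯(G-ord) is a count of the THEORY class, with no residual datum. -/
theorem classX3Gord_iff_subGord (hp2 : p ≠ 2) (hX : ClassX3 W p) :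
    ClassX3Gord W p ↔ SubGord W p := by
  rcases eq_three_or_five_le_of_prime_ne_two p hp.out hp2 with h3 | hp5
  · subst h3
    exact classX3Gord_three_iff_subGord W hX
  · exact ⟨fun h ↦ (subGord_iff_typeG_of_addv W p hp2 hX.2).mpr h.typeGOrd.typeG,
      fun h ↦ classX3Gord_of_subGord W p hp5 hX h⟩

/-- **On X4 with defect `≠ 2`, X4♯(G-ord) IS the census cell** (`p ≥ 5`):
`ClassX4 W p → e_E(p) ≠ 2 → (ClassX4Gord W p ↔ SubGord W p)` (gen 3's `classX4Gord_of_subGordHigher`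
and `TypeGOrd → TypeG → SubGord`). For defect `2` the census needs the extra ordinarity bit
`p ∤ a_p(E^{(p*)})` (gen 4 `classX4Gord_iff_goodOrd_twist_pStar`). -/
theorem classX4Gord_iff_subGord_of_semistabilityIndex_ne_two (hp5 : 5 ≤ p) (hX : ClassX4 W p)
    (hne2 : semistabilityIndex W p ≠ 2) : ClassX4Gord W p ↔ SubGord W p :=
  ⟨fun h ↦ (subGord_iff_typeG_of_addv W p (by omega) hX.2.1).mpr h.typeGOrd.typeG,
    fun h ↦ classX4Gord_of_subGordHigher W p hp5 hX ⟨h, hne2⟩⟩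

/-- **X3♯(G-ord) ∪ X4♯(G-ord) pairs lie in the census cell (G-ord)** (every odd `p`):
`TypeGOrd W p → Addv W p → SubGord W p` — no (G)-ordinary pair is counted under (M), (T′) or (W). -/
theorem subGord_of_typeGOrd_of_addv (hp2 : p ≠ 2) (hG : TypeGOrd W p) (hadd : Addv W p) :
    SubGord W p :=
  (subGord_iff_typeG_of_addv W p hp2 hadd).mpr hG.typeG

end Summit.BirchSwinnertonDyer.Rank1Residual.Additive

end
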